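import Summits.Ventures.HSemireg.WedgeHankelSubstitutionSemisimple
import Summits.Ventures.HSemireg.WedgeHankelSubstitutionSemisimpleUpper

/-!
# Venture HSemireg — THE MINIMAL POLYNOMIAL OF A SEMISIMPLE SUBSTITUTION ON TH-7's CLASSES WITH COINCIDENT WEIGHTS: `minpoly (SbC g) = Π over the DISTINCT weights (X − C μ)`
# (two fixed nodes in `K`, or an upper / diagonal substitution), from a general lemma «an endomorphism with an eigenbasis has minimal polynomial the product of `X − μ`
# over its distinct eigenvalues»; hence the swap has `minpoly = X² − 1` and the negative scalings `SbC(t 0 0 −t)` have `minpoly = (X − t^n)(X + t^n)` (`n ≥ 1`, `2 ≠ 0`)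

HONEST FRAMING. Part of the Lean index of the computation cell `pub-hsemireg` (seat p10 gen 21, Sunday typer «UNIFORM-IN-n»).
Finite-dimensional EXTERIOR ALGEBRA + linear algebra ONLY: no variety, no cohomology theory, no sheaf, no Ext group, no semiregularity map;
nothing here says that HC / HC_CM / HC_AV holds; no Literature fact is declared or used.  Custodian versions as in `WedgeHankelSiegelIdeal` (1/3) and `WedgeHankelFrameChange`;
the dictionary (the class space = `Sym^n` of the letters' plane; a semisimple `g` acts diagonally with the `Sym^n` weights `a^{n−p} b^p`) is QUOTED, never asserted.

WHAT IS IN THE TREE.  J17 (`WedgeHankelSubstitutionSemisimple`): `exists_eigenbasis_SbC_of_fixed_two` (two distinct fixed nodes `λ₁ ≠ λ₂` in `K`: eigenBASIS with weights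
`(α+λ₁γ)^{n−p}(α+λ₂γ)^p`), `minpoly_SbC_of_fixed_two_of_injective` (DISTINCT weights: `minpoly = Π_p (X − C μ_p)`); J19 (`WedgeHankelSubstitutionSemisimpleUpper`):
`exists_eigenbasis_SbC_of_upper` / `_diag`, `minpoly_SbC_of_upper_of_injective` / `minpoly_SbC_diag_of_injective`.  Both leave the COINCIDENT-weight case open («`minpoly` =
product over DISTINCT weights», gen-20 OPEN (d)).  THIS FILE (namespace `Summit.Ventures.HSemireg.Wedge.HankelFrameChange` continued; imports J17 + J19) closes it:
* §271 GENERALITY: `aeval_prod_X_sub_C_apply_eq_zero` (a product `Π_{m ∈ S} (X − C m)` containing the factor `X − C μ` kills every `μ`-eigenvector),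
  **`minpoly_eq_prod_image_of_eigenbasis`: an endomorphism `T` with a basis `b` of eigenvectors, `T (b i) = μ_i • b i`, has `minpoly T = Π_{m ∈ image μ} (X − C m)`** (every
  field; the product over the DISTINCT eigenvalues), `natDegree_minpoly_eq_card_image_of_eigenbasis`.
* §272 TH-7's CLASSES: **`minpoly_SbC_of_fixed_two`** (two distinct fixed nodes, NO injectivity hypothesis: `minpoly (SbC g) = Π_{m ∈ {(α+λ₁γ)^{n−p}(α+λ₂γ)^p : p}} (X − C m)`),
  **`minpoly_SbC_of_upper`** (`β + λ₁δ = λ₁α`: product over the distinct `α^{n−p}δ^p`), **`minpoly_SbC_diag`**, `natDegree_minpoly_SbC_of_fixed_two` / `_of_upper` (degree =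
  number of distinct weights).
* §273 EXAMPLES with coincident weights: `image_mul_neg_pow_eq` (`{c^{n−p}(−c)^p : p ≤ n} = {c^n, −c^n}` for `n ≥ 1`), **`minpoly_SbC_diag_neg`: `minpoly (SbC(t 0 0 −t)) = (X − C t^n)(X − C (−t^n))`**
  (`n ≥ 1`, `t ≠ 0`, `2 ≠ 0` in `K`: weights `±t^n` alternate), and **`minpoly_SbC_swap`: `minpoly (SbC(0 1 1 0)) = (X − 1)(X + 1)`** (`n ≥ 1`, `2 ≠ 0`; fixed nodes `±1`,
  weights `(−1)^p`) — the swap is a non-scalar involution of th-7's class space.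
NOT typed here: characteristic `2` for the swap (fixed nodes coincide; the swap is then unipotent); the exact number of distinct weights `min(n+1, ord((α+λ₂γ)/(α+λ₁γ)))`;
anything Ext-side.  New names only.
-/

open Module

namespace Summit.Ventures.HSemireg.Wedge.HankelFrameChange

open Summit.Ventures.HSemireg.Wedge Summit.Ventures.HSemireg.Wedge.Kunneth Summit.Ventures.HSemireg.Wedge.Hankel
  Summit.Ventures.HSemireg.Wedge.BasisFree Summit.Ventures.HSemireg.Wedge.HankelSiegel Summit.Ventures.HSemireg.Wedge.HankelSiegelIdeal
  Summit.Ventures.HSemireg.Wedge.KunnethKernel Summit.Ventures.HSemireg.Wedge.HankelRankOne Summit.Ventures.HSemireg.Wedge.KernelDuality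

variable (K : Type*) [Field K] {n : ℕ}

/-! ## §271. Generality: the minimal polynomial of an endomorphism with an eigenbasis -/

section Eigenbasis

variable {V : Type*} [AddCommGroup V] [Module K V]

/-- a product `Π_{m ∈ S} (X − C m)` containing the factor `X − C μ` kills every vector `v` with `T v = μ • v`. -/
theorem aeval_prod_X_sub_C_apply_eq_zero [DecidableEq K] (T : V →ₗ[K] V) {S : Finset K} {μ : K} (hμ : μ ∈ S) {v : V} (hv : T v = μ • v) :
    Polynomial.aeval T (∏ m ∈ S, (Polynomial.X - Polynomial.C m)) v = 0 := by
  rw [← Finset.prod_erase_mul S _ hμ, map_mul, Module.End.mul_apply, map_sub, Polynomial.aeval_X, Polynomial.aeval_C, LinearMap.sub_apply, hv,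
    Module.algebraMap_end_apply, sub_self, map_zero]

variable [FiniteDimensional K V]

/-- **AN ENDOMORPHISM WITH AN EIGENBASIS HAS MINIMAL POLYNOMIAL THE PRODUCT OF `X − μ` OVER ITS DISTINCT EIGENVALUES**: if `T (b i) = μ_i • b i` for a basis `b`, then
`minpoly T = Π_{m ∈ image μ} (X − C m)` (every field: the product kills the basis; each `X − C μ_i` divides the minimal polynomial; distinct linear factors are coprime). -/
theorem minpoly_eq_prod_image_of_eigenbasis [DecidableEq K] {ι : Type*} [Fintype ι] (T : V →ₗ[K] V) (b : Basis ι K V) (μ : ι → K) (hb : ∀ i, T (b i) = μ i • b i) :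
    minpoly K T = ∏ m ∈ Finset.univ.image μ, (Polynomial.X - Polynomial.C m) := by
  have hT : IsIntegral K T := Algebra.IsIntegral.isIntegral _
  have h1 : minpoly K T ∣ ∏ m ∈ Finset.univ.image μ, (Polynomial.X - Polynomial.C m) := by
    refine minpoly.dvd K _ (b.ext fun i => ?_)
    rw [LinearMap.zero_apply]
    exact aeval_prod_X_sub_C_apply_eq_zero K T (Finset.mem_image_of_mem μ (Finset.mem_univ i)) (hb i)
  have h2 : (∏ m ∈ Finset.univ.image μ, (Polynomial.X - Polynomial.C m)) ∣ minpoly K T := by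
    refine Finset.prod_dvd_of_coprime (fun m _ m' _ hmm' => Polynomial.pairwise_coprime_X_sub_C Function.injective_id hmm') fun m hm => ?_
    obtain ⟨i, _, rfl⟩ := Finset.mem_image.mp hm
    exact Polynomial.dvd_iff_isRoot.mpr (Module.End.isRoot_of_hasEigenvalue
      (Module.End.hasEigenvalue_of_hasEigenvector (Module.End.hasEigenvector_iff.mpr ⟨Module.End.mem_eigenspace_iff.mpr (hb i), b.ne_zero i⟩)))
  exact Polynomial.eq_of_monic_of_associated (minpoly.monic hT) (Polynomial.monic_prod_of_monic _ _ fun m _ => Polynomial.monic_X_sub_C m) (associated_of_dvd_dvd h1 h2)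

/-- hence **`deg minpoly T` = the number of distinct eigenvalues**. -/
theorem natDegree_minpoly_eq_card_image_of_eigenbasis [DecidableEq K] {ι : Type*} [Fintype ι] (T : V →ₗ[K] V) (b : Basis ι K V) (μ : ι → K)
    (hb : ∀ i, T (b i) = μ i • b i) : (minpoly K T).natDegree = (Finset.univ.image μ).card := by
  rw [minpoly_eq_prod_image_of_eigenbasis K T b μ hb, Polynomial.natDegree_prod_of_monic _ _ fun m _ => Polynomial.monic_X_sub_C m]
  simp only [Polynomial.natDegree_X_sub_C, Finset.sum_const, smul_eq_mul, mul_one]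

end Eigenbasis

/-! ## §272. The minimal polynomial of a semisimple substitution on th-7's classes, coincident weights allowed -/

open Classical in
/-- **TWO DISTINCT FIXED NODES `λ₁ ≠ λ₂` IN `K`: `minpoly (SbC g) = Π over the DISTINCT weights `(α+λ₁γ)^{n−p}(α+λ₂γ)^p` of `X − C μ`** (no injectivity hypothesis; J17's
eigenbasis + §271). -/
theorem minpoly_SbC_of_fixed_two {α β γ δ l₁ l₂ : K} (h₁₂ : l₁ ≠ l₂) (e₁ : β + l₁ * δ = l₁ * (α + l₁ * γ)) (e₂ : β + l₂ * δ = l₂ * (α + l₂ * γ)) :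
    minpoly K (SbC K α β γ δ (n := n)) =
      ∏ m ∈ Finset.univ.image (fun p : Fin (n + 1) => (α + l₁ * γ) ^ (n - (p : ℕ)) * (α + l₂ * γ) ^ (p : ℕ)), (Polynomial.X - Polynomial.C m) := by
  obtain ⟨b, hb⟩ := exists_eigenbasis_SbC_of_fixed_two K (n := n) h₁₂ e₁ e₂
  exact minpoly_eq_prod_image_of_eigenbasis K _ b _ hb

open Classical in
/-- the degree of the minimal polynomial = the number of distinct weights (two distinct fixed nodes). -/
theorem natDegree_minpoly_SbC_of_fixed_two {α β γ δ l₁ l₂ : K} (h₁₂ : l₁ ≠ l₂) (e₁ : β + l₁ * δ = l₁ * (α + l₁ * γ)) (e₂ : β + l₂ * δ = l₂ * (α + l₂ * γ)) :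
    (minpoly K (SbC K α β γ δ (n := n))).natDegree = (Finset.univ.image fun p : Fin (n + 1) => (α + l₁ * γ) ^ (n - (p : ℕ)) * (α + l₂ * γ) ^ (p : ℕ)).card := by
  obtain ⟨b, hb⟩ := exists_eigenbasis_SbC_of_fixed_two K (n := n) h₁₂ e₁ e₂
  exact natDegree_minpoly_eq_card_image_of_eigenbasis K _ b _ hb

open Classical in
/-- **AN UPPER SUBSTITUTION WITH A FINITE FIXED NODE (`β + λ₁δ = λ₁α`): `minpoly (SbC(α β 0 δ)) = Π over the DISTINCT `α^{n−p}δ^p` of `X − C μ`** (J19's eigenbasis). -/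
theorem minpoly_SbC_of_upper {α β δ l₁ : K} (e₁ : β + l₁ * δ = l₁ * α) :
    minpoly K (SbC K α β 0 δ (n := n)) = ∏ m ∈ Finset.univ.image (fun p : Fin (n + 1) => α ^ (n - (p : ℕ)) * δ ^ (p : ℕ)), (Polynomial.X - Polynomial.C m) := by
  obtain ⟨b, hb⟩ := exists_eigenbasis_SbC_of_upper K (n := n) e₁
  exact minpoly_eq_prod_image_of_eigenbasis K _ b _ hb

open Classical in
/-- the degree of the minimal polynomial of an upper substitution = the number of distinct `α^{n−p}δ^p`. -/
theorem natDegree_minpoly_SbC_of_upper {α β δ l₁ : K} (e₁ : β + l₁ * δ = l₁ * α) :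
    (minpoly K (SbC K α β 0 δ (n := n))).natDegree = (Finset.univ.image fun p : Fin (n + 1) => α ^ (n - (p : ℕ)) * δ ^ (p : ℕ)).card := by
  obtain ⟨b, hb⟩ := exists_eigenbasis_SbC_of_upper K (n := n) e₁
  exact natDegree_minpoly_eq_card_image_of_eigenbasis K _ b _ hb

open Classical in
/-- **THE DIAGONAL TORUS: `minpoly (SbC(a 0 0 d)) = Π over the DISTINCT `a^{n−p}d^p` of `X − C μ`.** -/
theorem minpoly_SbC_diag (a d : K) :
    minpoly K (SbC K a 0 0 d (n := n)) = ∏ m ∈ Finset.univ.image (fun p : Fin (n + 1) => a ^ (n - (p : ℕ)) * d ^ (p : ℕ)), (Polynomial.X - Polynomial.C m) :=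
  minpoly_SbC_of_upper K (l₁ := 0) (by rw [zero_mul, zero_mul, add_zero])

/-! ## §273. Examples with coincident weights: negative scalings and the swap -/

open Classical in
/-- `n ≥ 1`: the distinct values of `c^{n−p}(−c)^p`, `p ≤ n`, are exactly `c^n` and `−c^n`. -/
theorem image_mul_neg_pow_eq (hn : 1 ≤ n) (c : K) :
    Finset.univ.image (fun p : Fin (n + 1) => c ^ (n - (p : ℕ)) * (-c) ^ (p : ℕ)) = {c ^ n, -c ^ n} := by
  have hw : ∀ p : Fin (n + 1), c ^ (n - (p : ℕ)) * (-c) ^ (p : ℕ) = (-1) ^ (p : ℕ) * c ^ n := fun p => by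
    rw [neg_eq_neg_one_mul, mul_pow, mul_left_comm, ← pow_add, Nat.sub_add_cancel (Nat.le_of_lt_succ p.2)]
  ext m
  simp only [Finset.mem_image, Finset.mem_univ, true_and, Finset.mem_insert, Finset.mem_singleton, hw]
  constructor
  · rintro ⟨p, rfl⟩
    rcases neg_one_pow_eq_or K (p : ℕ) with h | h
    · left; rw [h, one_mul]
    · right; rw [h, neg_one_mul]
  · rintro (rfl | rfl)
    · exact ⟨⟨0, by omega⟩, show (-1 : K) ^ 0 * c ^ n = c ^ n by rw [pow_zero, one_mul]⟩
    · exact ⟨⟨1, by omega⟩, show (-1 : K) ^ 1 * c ^ n = -c ^ n by rw [pow_one, neg_one_mul]⟩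

/-- **THE NEGATIVE SCALINGS: `minpoly (SbC(t 0 0 −t)) = (X − C t^n)·(X − C(−t^n))`** on th-7's classes (`n ≥ 1`, `t ≠ 0`, `2 ≠ 0` in `K`; the weights `t^{n−p}(−t)^p = ±t^n`
alternate, so the spectrum has exactly two points although `charpoly` has degree `n + 1`). -/
theorem minpoly_SbC_diag_neg (hn : 1 ≤ n) (h2 : (2 : K) ≠ 0) {t : K} (ht : t ≠ 0) :
    minpoly K (SbC K t 0 0 (-t) (n := n)) = (Polynomial.X - Polynomial.C (t ^ n)) * (Polynomial.X - Polynomial.C (-t ^ n)) := by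
  classical
  have hne : t ^ n ∉ ({-t ^ n} : Finset K) := by
    rw [Finset.mem_singleton]
    intro h
    have h0 : (2 : K) * t ^ n = 0 := by rw [two_mul, add_eq_zero_iff_eq_neg]; exact h
    exact mul_ne_zero h2 (pow_ne_zero n ht) h0
  rw [minpoly_SbC_diag, image_mul_neg_pow_eq K hn t, Finset.prod_insert hne, Finset.prod_singleton]

/-- **THE SWAP: `minpoly (SbC(0 1 1 0)) = (X − 1)·(X + 1)` on th-7's classes** (`n ≥ 1`, `2 ≠ 0` in `K`): fixed nodes `1 ≠ −1`, weights `(0 + 1·1)^{n−p}(0 + (−1)·1)^p = (−1)^p` —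
a non-scalar involution (compare J9/J13: together with the shear it generates an irreducible action with scalar commutant when `n! ≠ 0`). -/
theorem minpoly_SbC_swap (hn : 1 ≤ n) (h2 : (2 : K) ≠ 0) :
    minpoly K (SbC K 0 1 1 0 (n := n)) = (Polynomial.X - Polynomial.C 1) * (Polynomial.X - Polynomial.C (-1)) := by
  classical
  have h₁₂ : (1 : K) ≠ -1 := fun h => h2 (by rw [show (2 : K) = 1 - (-1) by ring, ← h, sub_self])
  have e₁ : (1 : K) + 1 * 0 = 1 * (0 + 1 * 1) := by ring
  have e₂ : (1 : K) + (-1) * 0 = (-1) * (0 + (-1) * 1) := by ring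
  have hf : (fun p : Fin (n + 1) => (0 + 1 * 1 : K) ^ (n - (p : ℕ)) * (0 + (-1) * 1) ^ (p : ℕ)) = fun p : Fin (n + 1) => (1 : K) ^ (n - (p : ℕ)) * (-1) ^ (p : ℕ) := by
    funext p; rw [zero_add, zero_add, one_mul, neg_one_mul]
  have hne : (1 : K) ∉ ({-1} : Finset K) := by rw [Finset.mem_singleton]; exact h₁₂
  rw [minpoly_SbC_of_fixed_two K h₁₂ e₁ e₂, hf, image_mul_neg_pow_eq K hn 1, one_pow, Finset.prod_insert hne, Finset.prod_singleton]

end Summit.Ventures.HSemireg.Wedge.HankelFrameChange
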